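import Summits.CriticalPhenomena.SAWScalingLimit.Theses.SAWMassiveIsingTilt
import Summits.CriticalPhenomena.SAWScalingLimit.Theorems.SAWMassiveIsingTiltMassiveWindowSLEStubZloopMixingEdgeBound
import Summits.CriticalPhenomena.SAWScalingLimit.Theorems.SAWMassiveIsingTiltMassiveWindowSLEStubZloopEdgeCalculus
import Summits.CriticalPhenomena.SAWScalingLimit.Theorems.SAWDevelopingMapObservableToSLERestrictionCocycleHelpersFloor
import Literature.NumberTheory.Sieve.CFSemigroupPowFamily
import HarnessLib

/-!
# Crux `MassiveWindowSLE` (stmt-CriticalPhenomena-7685), line `registered`, skeleton r8 —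
# stub F2 `stub_zloopRatioMixingCore`: the fixed-mesh core of the ratio-mixing engine

Route `route-CriticalPhenomena-SAWMassiveIsingTilt` (CriticalPhenomena / SAWScalingLimit). Second of
the three registered pieces F1 `stub_zloopMixingEdgeBound` (landed, imported) → F2 (this file) → F3
`stub_zloopRateRatioMixing` of the engine (RATE-form window ratio mixing of the loop-gas bath).
Notation: `Zloop H S y` is the loop-`O(1)` partition function of `H` read inside `S`
(`Theorems/SAWMassiveIsingTiltDefs.lean`); `W⟦H, S, u, v, t⟧` is the parse-time notation for the
two-point numerator (the finsum spelled out in the registered signatures).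

**F2.** For `H' ≤ H ≤ hexGraph` with `E(H)` finite, a vertex set `V'` carrying `H'`, `K ⊆ ℂ`, a mesh
`δ` with `16δ ≤ ε`, a weight `0 ≤ y ≤ 3/5`, a rate `c ≥ 0`, the discrepancy property (every `H`-edge
at a `V'`-vertex missing from `H'` is within `δ` of `K`), RATE at `y`, and the smallness
`#E(H) · 18 (C₀(ε/(4δ)+1)²)² e^{-cε/(8δ)} ≤ log(1 + θ)`, any two vertex sets `S₁, S₂` whose
complements lie in `V'` and are `ε`-far from `K` satisfy
`Zloop(H, S₁)·Zloop(H', S₂) ≤ (1 + θ)·Zloop(H', S₁)·Zloop(H, S₂)`.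
Proof. Decompose `E(H) = E(H') ⊔ FREE ⊔ ATT` (`FREE` = the `H`-edges with no endpoint in `V'`,
`ATT` = the `H`-edges missing from `H'` with an endpoint in `V'`). Malg(b)
(`stub_zloopEdgeCalculus.2`) factors `Zloop(H' ⊔ FREE, S_j) = Zloop(H', S_j)·Zloop(FREE, S_j)` and
`Zloop(FREE, S₁) = Zloop(FREE, S₂)` (`mix_zloop_congr_set`: FREE avoids `V' ⊇ S_jᶜ`). Malg(a)
(`stub_zloopEdgeCalculus.1`) telescopes the ATT edges in a fixed order (`mix_telescope`):
`log Zloop(H, S_j) − log Zloop(H' ⊔ FREE, S_j) = Σ_e log(1 + y·a_e^j)`, `a_e^j = W/Zloop ≥ 0` in the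
current graph, and `|log(1 + y a) − log(1 + y b)| ≤ |a − b|` for `0 ≤ y ≤ 1`
(`abs_log_sub_log_le`). Every honeycomb vertex within `ρ = ε/(4δ) ≥ 4` of an attachment edge is
within `δ(ρ + 2) < ε` of `K`, hence in `S₁ ∩ S₂`, so F1 (with `β = artanh y ≤ 1`, `mix_exists_beta`)
bounds `|a_e¹ − a_e²| ≤ η = 18 (C₀(ρ+1)²)² e^{-c ρ/2}`; summing, `|log R(S₁) − log R(S₂)| ≤ #ATT · η ≤
log(1 + θ)` with `R(S) = Zloop(H, S)/Zloop(H', S)`; exponentiate.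

References: S. Friedli, Y. Velenik, *Statistical Mechanics of Lattice Systems* (CUP 2017), §3.7
[FriedliVelenik2017]; G. F. Lawler, O. Schramm, W. Werner, J. Amer. Math. Soc. 16 (2003), §3
[LawlerSchrammWerner2003Restriction]. No new facts are cited.
-/

noncomputable section

namespace Summit.CriticalPhenomena.SAWScalingLimit.Theorems.MassiveWindowSLE.Birth

open scoped BigOperators Topology Classical MeasureTheory NNReal ENNReal
open Filter Set MeasureTheory
open Literature.Probability Literature.Probability.LatticeModels Literature.Probability.RandomPlanarGeometry
open Summit.CriticalPhenomena.SAWScalingLimit.Theorems.SAWMassiveIsingTilt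
open Summit.CriticalPhenomena.SAWScalingLimit.Theorems.PolygonParitySqueeze.ZigzagDiscretisation
  (dist_hexCenter_lt_one_of_adj)
open Summit.CriticalPhenomena.SAWScalingLimit.Theorems.ObservableToSLE.FloorRatio (dist_smul_mesh)
open Literature.NumberTheory.Sieve.CfThreshold (abs_log_sub_log_le)

/-- `W⟦H, S, u, v, t⟧`: parse-time notation for the loop-gas two-point numerator `W_H(S; u, v)(t)`
(the finsum spelled out in the registered signatures). -/
local notation3 (prettyPrint := false) "W⟦" H ", " S ", " u ", " v ", " t "⟧" =>
  (∑ᶠ E ∈ {E : Finset (Sym2 Literature.Probability.LatticeModels.HexVertex) |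
    (∀ e ∈ E, e ∈ (H).edgeSet ∧ ∀ w ∈ e, w ∈ S) ∧
      ∀ w : Literature.Probability.LatticeModels.HexVertex,
        (Odd (E.filter (fun e => w ∈ e)).card ↔ (w = u ∨ w = v))}, t ^ E.card)

/-! ### Helpers -/

/-- `Zloop(H, S; y)` only depends on `S` through the admissible edges: if every edge of `H` has
its endpoints in `S₁` iff in `S₂`, the two partition functions agree. -/
theorem mix_zloop_congr_set {H : SimpleGraph HexVertex} {S₁ S₂ : Set HexVertex} (y : ℝ)
    (h : ∀ e ∈ H.edgeSet, ∀ w ∈ e, (w ∈ S₁ ↔ w ∈ S₂)) : Zloop H S₁ y = Zloop H S₂ y := by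
  unfold Zloop
  have hs : {E : Finset (Sym2 HexVertex) | (∀ e ∈ E, e ∈ H.edgeSet ∧ ∀ v ∈ e, v ∈ S₁) ∧
      ∀ v : HexVertex, Even (E.filter (fun e => v ∈ e)).card} =
      {E : Finset (Sym2 HexVertex) | (∀ e ∈ E, e ∈ H.edgeSet ∧ ∀ v ∈ e, v ∈ S₂) ∧
      ∀ v : HexVertex, Even (E.filter (fun e => v ∈ e)).card} := by
    ext E
    simp only [Set.mem_setOf_eq]
    refine and_congr_left fun _ => forall₂_congr fun e _ => ?_
    constructor
    · exact fun h' => ⟨h'.1, fun w hw => (h e h'.1 w hw).1 (h'.2 w hw)⟩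
    · exact fun h' => ⟨h'.1, fun w hw => (h e h'.1 w hw).2 (h'.2 w hw)⟩
  rw [hs]

/-- For `0 ≤ y ≤ 3/5` the inverse temperature `β = artanh y` has `0 ≤ β ≤ 1` and `tanh β = y`. -/
theorem mix_exists_beta {y : ℝ} (hy0 : 0 ≤ y) (hy1 : y ≤ 3 / 5) :
    ∃ β : ℝ, 0 ≤ β ∧ β ≤ 1 ∧ Real.tanh β = y := by
  refine ⟨Real.artanh y, Real.artanh_nonneg hy0, ?_, Real.tanh_artanh ⟨by linarith, by linarith⟩⟩
  have h35 : Real.artanh (3 / 5) ≤ 1 := by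
    have h4 : Real.sqrt ((1 + 3 / 5) / (1 - 3 / 5)) = 2 := by
      rw [show ((1 : ℝ) + 3 / 5) / (1 - 3 / 5) = 2 ^ 2 by norm_num, Real.sqrt_sq (by norm_num)]
    rw [Real.artanh, h4]
    linarith [Real.log_two_lt_d9]
  exact (Real.artanh_le_artanh (by linarith) (by norm_num) hy1).trans h35

/-! ### Telescoping over the attachment edges -/

/-- **Telescoping.** Adding the edges of a finset `A` (non-diagonal, not in `G₀`, endpoints in
`S₁ ∩ S₂`) to a graph `G₀` with finitely many edges one at a time, Malg(a) gives
`log Zloop(G₀ + A, S_j) − log Zloop(G₀, S_j) = Σ_e log(1 + y·a_e^j)`, `a_e^j = W/Zloop ≥ 0` in the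
current graph; if every such two-point ratio differs between `S₁` and `S₂` by at most `η`, the two
increments differ by at most `#A · η` (`|log(1 + y a) − log(1 + y b)| ≤ |a − b|` for `0 ≤ y ≤ 1`). -/
theorem mix_telescope {G₀ : SimpleGraph HexVertex} (hG₀ : G₀.edgeSet.Finite) {S₁ S₂ : Set HexVertex}
    {y η : ℝ} (hy0 : 0 ≤ y) (hy1 : y ≤ 1) (A : Finset (Sym2 HexVertex))
    (hA : ∀ e ∈ A, ¬ e.IsDiag ∧ e ∉ G₀.edgeSet ∧ ∀ w ∈ e, w ∈ S₁ ∧ w ∈ S₂)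
    (hB : ∀ A' ⊆ A, ∀ u v : HexVertex, s(u, v) ∈ A → s(u, v) ∉ A' →
      |W⟦G₀ ⊔ SimpleGraph.fromEdgeSet ↑A', S₁, u, v, y⟧ /
            Zloop (G₀ ⊔ SimpleGraph.fromEdgeSet ↑A') S₁ y -
          W⟦G₀ ⊔ SimpleGraph.fromEdgeSet ↑A', S₂, u, v, y⟧ /
            Zloop (G₀ ⊔ SimpleGraph.fromEdgeSet ↑A') S₂ y| ≤ η) :
    |Real.log (Zloop (G₀ ⊔ SimpleGraph.fromEdgeSet ↑A) S₁ y) - Real.log (Zloop G₀ S₁ y) -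
        (Real.log (Zloop (G₀ ⊔ SimpleGraph.fromEdgeSet ↑A) S₂ y) - Real.log (Zloop G₀ S₂ y))| ≤
      A.card * η := by
  induction A using Finset.induction_on with
  | empty =>
    simp only [Finset.coe_empty, SimpleGraph.fromEdgeSet_empty, sup_bot_eq, sub_self, abs_zero,
      Finset.card_empty, Nat.cast_zero, zero_mul, le_refl]
  | insert e A heA ih =>
    have ih' := ih (fun e' he' => hA e' (Finset.mem_insert_of_mem he'))
      (fun A' hA' u v huv huv' => hB A' (hA'.trans (Finset.subset_insert _ _)) u v
        (Finset.mem_insert_of_mem huv) huv')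
    obtain ⟨hdiag, heG₀, heS⟩ := hA e (Finset.mem_insert_self _ _)
    induction e using Sym2.ind with
    | h u v =>
    have huv : u ≠ v := fun h => hdiag (Sym2.mk_isDiag_iff.2 h)
    set G := G₀ ⊔ SimpleGraph.fromEdgeSet (↑A : Set (Sym2 HexVertex)) with hGdef
    have hGfin : G.edgeSet.Finite := by
      rw [hGdef, SimpleGraph.edgeSet_sup, SimpleGraph.edgeSet_fromEdgeSet]
      exact hG₀.union (A.finite_toSet.subset Set.sdiff_subset)
    have hGadj : ¬ G.Adj u v := by
      rw [hGdef, SimpleGraph.sup_adj, SimpleGraph.fromEdgeSet_adj, Finset.mem_coe]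
      rintro (h | h)
      · exact heG₀ ((SimpleGraph.mem_edgeSet G₀).2 h)
      · exact heA h.1
    have hins : G₀ ⊔ SimpleGraph.fromEdgeSet (↑(insert s(u, v) A) : Set (Sym2 HexVertex)) =
        G ⊔ SimpleGraph.fromEdgeSet {s(u, v)} := by
      rw [hGdef, Finset.coe_insert, Set.insert_eq, SimpleGraph.fromEdgeSet_union, sup_left_comm,
        sup_comm]
    rw [hins]
    obtain ⟨hu1, hu2⟩ := heS u (Sym2.mem_mk_left u v)
    obtain ⟨hv1, hv2⟩ := heS v (Sym2.mem_mk_right u v)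
    have hZ1 : 1 ≤ Zloop G S₁ y := mix_one_le_zloop (hGfin.subset fun _ he => he.1) hy0
    have hZ2 : 1 ≤ Zloop G S₂ y := mix_one_le_zloop (hGfin.subset fun _ he => he.1) hy0
    set a₁ := W⟦G, S₁, u, v, y⟧ / Zloop G S₁ y with ha₁
    set a₂ := W⟦G, S₂, u, v, y⟧ / Zloop G S₂ y with ha₂
    have ha₁0 : 0 ≤ a₁ := div_nonneg (mix_W_nonneg G S₁ u v hy0) (by linarith)
    have ha₂0 : 0 ≤ a₂ := div_nonneg (mix_W_nonneg G S₂ u v hy0) (by linarith)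
    have hstep : ∀ {S : Set HexVertex}, u ∈ S → v ∈ S → 1 ≤ Zloop G S y →
        Real.log (Zloop (G ⊔ SimpleGraph.fromEdgeSet {s(u, v)}) S y) =
          Real.log (Zloop G S y) + Real.log (1 + y * (W⟦G, S, u, v, y⟧ / Zloop G S y)) := by
      intro S hu hv hZ
      have hW : 0 ≤ W⟦G, S, u, v, y⟧ := mix_W_nonneg G S u v hy0
      have h1 : 0 < 1 + y * (W⟦G, S, u, v, y⟧ / Zloop G S y) := by positivity
      rw [stub_zloopEdgeCalculus.1 G S y u v hGfin huv hGadj hu hv,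
        ← Real.log_mul (by linarith) h1.ne']
      congr 1
      field_simp
    have hbd : |a₁ - a₂| ≤ η :=
      hB A (Finset.subset_insert _ _) u v (Finset.mem_insert_self _ _) heA
    have hlog : |Real.log (1 + y * a₁) - Real.log (1 + y * a₂)| ≤ η := by
      calc |Real.log (1 + y * a₁) - Real.log (1 + y * a₂)|
          ≤ |(1 + y * a₁) - (1 + y * a₂)| :=
            abs_log_sub_log_le (by nlinarith) (by nlinarith)
        _ = y * |a₁ - a₂| := by
            rw [add_sub_add_left_eq_sub, ← mul_sub, abs_mul, abs_of_nonneg hy0]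
        _ ≤ 1 * η := mul_le_mul hy1 hbd (abs_nonneg _) zero_le_one
        _ = η := one_mul η
    rw [hstep hu1 hv1 hZ1, hstep hu2 hv2 hZ2, Finset.card_insert_of_notMem heA]
    push_cast
    have key : Real.log (Zloop G S₁ y) + Real.log (1 + y * a₁) - Real.log (Zloop G₀ S₁ y) -
        (Real.log (Zloop G S₂ y) + Real.log (1 + y * a₂) - Real.log (Zloop G₀ S₂ y)) =
        (Real.log (Zloop G S₁ y) - Real.log (Zloop G₀ S₁ y) -
          (Real.log (Zloop G S₂ y) - Real.log (Zloop G₀ S₂ y))) +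
        (Real.log (1 + y * a₁) - Real.log (1 + y * a₂)) := by ring
    rw [key]
    calc _ ≤ |Real.log (Zloop G S₁ y) - Real.log (Zloop G₀ S₁ y) -
            (Real.log (Zloop G S₂ y) - Real.log (Zloop G₀ S₂ y))| +
          |Real.log (1 + y * a₁) - Real.log (1 + y * a₂)| := abs_add_le _ _
      _ ≤ (A.card : ℝ) * η + η := add_le_add ih' hlog
      _ = ((A.card : ℝ) + 1) * η := by ring

/-! ### The registered stub F2: the core estimate at a fixed mesh -/

/-- **Stub F2 `stub_zloopRatioMixingCore` (fixed-mesh core of the engine).** For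
`H' ≤ H ≤ hexGraph` with `E(H)` finite, `V'` containing the endpoints of the `H'`-edges, the
discrepancy property (every `H`-edge missing from `H'` at a `V'`-vertex is within `δ` of `K`), the
counting bound, RATE at weight `y ∈ [0, 3/5]` with rate `c ≥ 0`, `16δ ≤ ε`, two vertex sets
`S₁, S₂` whose complements lie in `V'` and are `ε`-far from `K`, and the smallness
`#E(H) · 18 (C₀(ε/(4δ)+1)²)² e^{-cε/(8δ)} ≤ log(1+θ)`:
`Zloop(H, S₁)·Zloop(H', S₂) ≤ (1 + θ)·Zloop(H', S₁)·Zloop(H, S₂)`. Proof: decomposition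
`E(H) = E(H') ⊔ FREE ⊔ ATT`, factorisation (Malg(b)), telescoping over `ATT` (`mix_telescope`) with
the per-edge bound F1 (`stub_zloopMixingEdgeBound`, radius `ρ = ε/(4δ)`), `#ATT · η ≤ log(1 + θ)`. -/
theorem stub_zloopRatioMixingCore :
    ∀ (C₀ : ℝ), (∀ (z : ℂ) (ρ : ℝ), 0 ≤ ρ → {w : Literature.Probability.LatticeModels.HexVertex | dist (Literature.Probability.LatticeModels.hexCenter w) z ≤ ρ}.Finite ∧ (({w : Literature.Probability.LatticeModels.HexVertex | dist (Literature.Probability.LatticeModels.hexCenter w) z ≤ ρ}.ncard : ℝ) ≤ C₀ * (ρ + 1) ^ 2)) → ∀ (H H' : SimpleGraph Literature.Probability.LatticeModels.HexVertex), H ≤ Literature.Probability.LatticeModels.hexGraph → H.edgeSet.Finite → H' ≤ H → ∀ (V' : Set Literature.Probability.LatticeModels.HexVertex), (∀ u w : Literature.Probability.LatticeModels.HexVertex, H'.Adj u w → u ∈ V') → ∀ (K : Set ℂ) (δ ε θ y cδ NE : ℝ), 0 < δ → 16 * δ ≤ ε → 0 < θ → 0 ≤ y → y ≤ 3 / 5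 → 0 ≤ cδ → (∀ u w : Literature.Probability.LatticeModels.HexVertex, H.Adj u w → ¬ H'.Adj u w → u ∈ V' → ∃ k ∈ K, dist ((δ : ℂ) * Literature.Probability.LatticeModels.hexCenter u) k ≤ δ) → (∀ (Λ : Finset Literature.Probability.LatticeModels.HexVertex) (u v : Literature.Probability.LatticeModels.HexVertex), u ∈ Λ → v ∈ Λ → u ≠ v → (∑ᶠ E ∈ {E : Finset (Sym2 Literature.Probability.LatticeModels.HexVertex) | (∀ e ∈ E, e ∈ (Literature.Probability.LatticeModels.hexGraph).edgeSet ∧ ∀ w ∈ e, w ∈ (↑Λ : Set Literature.Probability.LatticeModels.HexVertex)) ∧ ∀ w : Literature.Probability.LatticeModels.HexVertex, (Odd (E.filter (fun e => w ∈ e)).card ↔ (w = u ∨ w = v))}, y ^ E.card) ≤ Real.exp (-(cδ * dist (Literature.Probability.LatticeModels.hexCenter u) (Literature.Probability.LatticeModels.hexCenter v))) * Summit.CriticalPhenomena.SAWScalingLimit.Theorems.SAWMassiveIsingTilt.Zloop Literature.Probability.LatticeModels.hexGraph (↑Λ : Set Literature.Probability.LatticeModels.HexVertex) y) → ((H.edgeSet.ncard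 : ℝ) ≤ NE) → NE * (18 * (C₀ * (ε / (4 * δ) + 1) ^ 2) ^ 2 * Real.exp (-(cδ * (ε / (8 * δ))))) ≤ Real.log (1 + θ) → ∀ (S₁ S₂ : Set Literature.Probability.LatticeModels.HexVertex), (∀ v : Literature.Probability.LatticeModels.HexVertex, v ∉ S₁ → v ∈ V') → (∀ v : Literature.Probability.LatticeModels.HexVertex, v ∉ S₂ → v ∈ V') → (∀ v : Literature.Probability.LatticeModels.HexVertex, v ∉ S₁ → ∀ k ∈ K, ε < dist ((δ : ℂ) * Literature.Probability.LatticeModels.hexCenter v) k) → (∀ v : Literature.Probability.LatticeModels.HexVertex, v ∉ S₂ → ∀ k ∈ K, ε < dist ((δ : ℂ) * Literature.Probability.LatticeModels.hexCenter v) k) → Summit.CriticalPhenomena.SAWScalingLimit.Theorems.SAWMassiveIsingTilt.Zloop H S₁ y * Summit.CriticalPhenomena.SAWScalingLimit.Theorems.SAWMassiveIsingTilt.Zloop H' S₂ y ≤ (1 + θ) * (Summit.CriticalPhenomena.SAWScalingLimit.Theorems.SAWMassiveIsingTilt.Zloop H' S₁ y * Summit.CriticalPhenomena.SAWScalingLimit.Theorems.SAWMassiveIsingTilt.Zloop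 H S₂ y) := by
  intro C₀ hC₀ H H' hHle hHfin hH'H V' hH'V K δ ε θ y cδ NE hδ hδε hθ hy0 hy1 hc hdisc hrate hNE hT
    S₁ S₂ hT₁ hT₂ hfar₁ hfar₂
  have hε : 0 < ε := by linarith
  -- the radius of the balls fed to F1 and the inverse temperature
  set ρ : ℝ := ε / (4 * δ) with hρdef
  have hδρ : δ * ρ = ε / 4 := by rw [hρdef]; field_simp
  have hρ4 : 4 ≤ ρ := by rw [hρdef, le_div_iff₀ (by positivity)]; linarith
  have hρ2 : ρ / 2 = ε / (8 * δ) := by rw [hρdef]; field_simp; ring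
  obtain ⟨β, hβ0, hβ1, hβy⟩ := mix_exists_beta hy0 hy1
  -- the edge finsets
  obtain ⟨ATT, hATT⟩ : ∃ ATT : Finset (Sym2 HexVertex), ∀ e, e ∈ ATT ↔
      e ∈ H.edgeSet ∧ e ∉ H'.edgeSet ∧ ∃ w ∈ e, w ∈ V' :=
    ⟨hHfin.toFinset.filter (fun e => e ∉ H'.edgeSet ∧ ∃ w ∈ e, w ∈ V'), fun e => by
      rw [Finset.mem_filter, Set.Finite.mem_toFinset]⟩
  obtain ⟨FREE, hFREE⟩ : ∃ FREE : Finset (Sym2 HexVertex), ∀ e, e ∈ FREE ↔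
      e ∈ H.edgeSet ∧ ∀ w ∈ e, w ∉ V' :=
    ⟨hHfin.toFinset.filter (fun e => ∀ w ∈ e, w ∉ V'), fun e => by
      rw [Finset.mem_filter, Set.Finite.mem_toFinset]⟩
  have hATTcard : (ATT.card : ℝ) ≤ NE := by
    refine le_trans ?_ hNE
    rw [Set.ncard_eq_toFinset_card _ hHfin]
    exact_mod_cast Finset.card_le_card fun e he => by
      rw [Set.Finite.mem_toFinset]
      exact ((hATT e).1 he).1
  -- the base graph `G₀ = H' ⊔ FREE`
  set G₀ : SimpleGraph HexVertex := H' ⊔ SimpleGraph.fromEdgeSet (↑FREE : Set (Sym2 HexVertex))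
    with hG₀def
  have hFle : SimpleGraph.fromEdgeSet (↑FREE : Set (Sym2 HexVertex)) ≤ H := by
    rw [SimpleGraph.fromEdgeSet_le]
    exact fun e he => ((hFREE e).1 (Finset.mem_coe.1 he.1)).1
  have hG₀le : G₀ ≤ H := sup_le hH'H hFle
  have hG₀fin : G₀.edgeSet.Finite := hHfin.subset (SimpleGraph.edgeSet_subset_edgeSet.2 hG₀le)
  have hH'fin : H'.edgeSet.Finite := hHfin.subset (SimpleGraph.edgeSet_subset_edgeSet.2 hH'H)
  have hFfin : (SimpleGraph.fromEdgeSet (↑FREE : Set (Sym2 HexVertex))).edgeSet.Finite :=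
    hHfin.subset (SimpleGraph.edgeSet_subset_edgeSet.2 hFle)
  -- the decomposition `H = G₀ ⊔ ATT`
  have hdec : G₀ ⊔ SimpleGraph.fromEdgeSet (↑ATT : Set (Sym2 HexVertex)) = H := by
    ext p q
    simp only [hG₀def, SimpleGraph.sup_adj, SimpleGraph.fromEdgeSet_adj, Finset.mem_coe, hATT,
      hFREE]
    constructor
    · rintro ((h' | ⟨⟨hpq, -⟩, -⟩) | ⟨⟨hpq, -⟩, -⟩)
      · exact hH'H h'
      · exact hpq
      · exact hpq
    · intro hpq
      by_cases h' : H'.Adj p q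
      · exact Or.inl (Or.inl h')
      · by_cases hV : p ∈ V' ∨ q ∈ V'
        · refine Or.inr ⟨⟨hpq, h', ?_⟩, hpq.ne⟩
          rcases hV with hV | hV
          · exact ⟨p, Sym2.mem_mk_left p q, hV⟩
          · exact ⟨q, Sym2.mem_mk_right p q, hV⟩
        · simp only [not_or] at hV
          refine Or.inl (Or.inr ⟨⟨hpq, ?_⟩, hpq.ne⟩)
          intro w hw
          rcases Sym2.mem_iff.1 hw with h | h
          · rw [h]; exact hV.1
          · rw [h]; exact hV.2
  -- vertices near an attachment edge are off both walks
  have hnear : ∀ u v : HexVertex, s(u, v) ∈ ATT → ∀ x : HexVertex,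
      dist (hexCenter x) (hexCenter u) ≤ ρ → x ∈ S₁ ∧ x ∈ S₂ := by
    intro u v he x hx
    obtain ⟨heH, heH', w, hw, hwV⟩ := (hATT _).1 he
    have hadj : H.Adj u v := heH
    have hadj' : ¬ H'.Adj u v := heH'
    obtain ⟨p, hpu, k, hk, hpk⟩ : ∃ p : HexVertex, dist (hexCenter p) (hexCenter u) ≤ 1 ∧
        ∃ k ∈ K, dist ((δ : ℂ) * hexCenter p) k ≤ δ := by
      rcases Sym2.mem_iff.1 hw with h | h
      · rw [h] at hwV
        obtain ⟨k, hk, hd⟩ := hdisc u v hadj hadj' hwV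
        exact ⟨u, by rw [dist_self]; norm_num, k, hk, hd⟩
      · rw [h] at hwV
        obtain ⟨k, hk, hd⟩ := hdisc v u hadj.symm (fun h'' => hadj' h''.symm) hwV
        exact ⟨v, (dist_hexCenter_lt_one_of_adj (hHle hadj.symm)).le, k, hk, hd⟩
    have hxp : dist (hexCenter x) (hexCenter p) ≤ ρ + 1 := by
      have := dist_triangle (hexCenter x) (hexCenter u) (hexCenter p)
      rw [dist_comm (hexCenter u) (hexCenter p)] at this
      linarith
    have hxk : dist ((δ : ℂ) * hexCenter x) k < ε := by
      calc dist ((δ : ℂ) * hexCenter x) k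
          ≤ dist ((δ : ℂ) * hexCenter x) ((δ : ℂ) * hexCenter p) + dist ((δ : ℂ) * hexCenter p) k :=
            dist_triangle _ _ _
        _ = δ * dist (hexCenter x) (hexCenter p) + dist ((δ : ℂ) * hexCenter p) k := by
            rw [dist_smul_mesh hδ.le]
        _ ≤ δ * (ρ + 1) + δ := add_le_add (mul_le_mul_of_nonneg_left hxp hδ.le) hpk
        _ = ε / 4 + 2 * δ := by rw [mul_add, hδρ]; ring
        _ < ε := by linarith
    constructor
    · by_contra hxS
      exact lt_irrefl _ ((hfar₁ x hxS k hk).trans hxk)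
    · by_contra hxS
      exact lt_irrefl _ ((hfar₂ x hxS k hk).trans hxk)
  -- telescoping over ATT
  set η : ℝ := 18 * (C₀ * (ρ + 1) ^ 2) ^ 2 * Real.exp (-(cδ * (ρ / 2))) with hηdef
  have htel := mix_telescope hG₀fin (S₁ := S₁) (S₂ := S₂) (η := η) hy0
    (hy1.trans (by norm_num)) ATT ?hA ?hB
  case hA =>
    intro e he
    obtain ⟨heH, heH', w, hw, hwV⟩ := (hATT _).1 he
    refine ⟨SimpleGraph.not_isDiag_of_mem_edgeSet _ heH, ?_, ?_⟩
    · rw [hG₀def, SimpleGraph.edgeSet_sup, SimpleGraph.edgeSet_fromEdgeSet]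
      rintro (h | h)
      · exact heH' h
      · exact ((hFREE e).1 (Finset.mem_coe.1 h.1)).2 w hw hwV
    · revert heH he
      induction e using Sym2.ind with
      | h u v =>
        intro he heH
        have hadj : hexGraph.Adj u v := hHle heH
        intro x hx
        rcases Sym2.mem_iff.1 hx with h | h
        · rw [h]
          exact hnear u v he u (by rw [dist_self]; linarith)
        · rw [h]
          refine hnear u v he v ?_
          have := dist_hexCenter_lt_one_of_adj hadj
          rw [dist_comm] at this
          linarith
  case hB =>
    intro A' hA' u v he heA'
    have hAle : SimpleGraph.fromEdgeSet (↑A' : Set (Sym2 HexVertex)) ≤ H := by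
      rw [SimpleGraph.fromEdgeSet_le]
      exact fun e he' => ((hATT e).1 (hA' (Finset.mem_coe.1 he'.1))).1
    have hGle : G₀ ⊔ SimpleGraph.fromEdgeSet (↑A' : Set (Sym2 HexVertex)) ≤ H := sup_le hG₀le hAle
    have hadj : hexGraph.Adj u v := hHle ((hATT _).1 he).1
    rw [hηdef]
    exact stub_zloopMixingEdgeBound C₀ hC₀ y cδ hy0 hrate hc β hβ0 hβ1 hβy _ (hGle.trans hHle)
      (hHfin.subset (SimpleGraph.edgeSet_subset_edgeSet.2 hGle)) S₁ S₂ ρ hρ4 u v hadj (hnear u v he)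
  -- factorisation of the base graph and independence of the free factor
  have hH'A : ∀ e ∈ H'.edgeSet, ∀ w ∈ e, w ∈ V' := by
    intro e he
    revert he
    induction e using Sym2.ind with
    | h p q =>
      intro he w hw
      have hadj : H'.Adj p q := he
      rcases Sym2.mem_iff.1 hw with h | h
      · rw [h]; exact hH'V p q hadj
      · rw [h]; exact hH'V q p hadj.symm
  have hFA : ∀ e ∈ (SimpleGraph.fromEdgeSet (↑FREE : Set (Sym2 HexVertex))).edgeSet,
      ∀ w ∈ e, w ∉ V' := by
    intro e he
    rw [SimpleGraph.edgeSet_fromEdgeSet] at he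
    exact ((hFREE e).1 (Finset.mem_coe.1 he.1)).2
  have hfac : ∀ S : Set HexVertex, Zloop G₀ S y =
      Zloop H' S y * Zloop (SimpleGraph.fromEdgeSet (↑FREE : Set (Sym2 HexVertex))) S y :=
    fun S => stub_zloopEdgeCalculus.2 H' _ S V' y hH'fin hFfin hH'A hFA
  have hFS : Zloop (SimpleGraph.fromEdgeSet (↑FREE : Set (Sym2 HexVertex))) S₁ y =
      Zloop (SimpleGraph.fromEdgeSet (↑FREE : Set (Sym2 HexVertex))) S₂ y := by
    refine mix_zloop_congr_set y fun e he w hw => ?_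
    have hwV := hFA e he w hw
    constructor
    · intro _
      by_contra h2
      exact hwV (hT₂ w h2)
    · intro _
      by_contra h1
      exact hwV (hT₁ w h1)
  -- positivity of all partition functions
  have hZ : ∀ {G : SimpleGraph HexVertex}, G ≤ H → ∀ S : Set HexVertex, 1 ≤ Zloop G S y :=
    fun hG S => mix_one_le_zloop
      ((hHfin.subset (SimpleGraph.edgeSet_subset_edgeSet.2 hG)).subset fun _ he => he.1) hy0
  obtain ⟨hZ1, hZ2, hZ1', hZ2', hZF⟩ :
      1 ≤ Zloop H S₁ y ∧ 1 ≤ Zloop H S₂ y ∧ 1 ≤ Zloop H' S₁ y ∧ 1 ≤ Zloop H' S₂ y ∧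
        1 ≤ Zloop (SimpleGraph.fromEdgeSet (↑FREE : Set (Sym2 HexVertex))) S₂ y :=
    ⟨hZ le_rfl S₁, hZ le_rfl S₂, hZ hH'H S₁, hZ hH'H S₂, hZ hFle S₂⟩
  -- the total is small
  have hηT : (ATT.card : ℝ) * η ≤ Real.log (1 + θ) := by
    refine le_trans ?_ hT
    rw [hηdef, hρ2]
    have hη0 : 0 ≤ 18 * (C₀ * (ρ + 1) ^ 2) ^ 2 * Real.exp (-(cδ * (ε / (8 * δ)))) := by positivity
    exact mul_le_mul_of_nonneg_right hATTcard hη0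
  rw [hdec, hfac S₁, hfac S₂, hFS, Real.log_mul (by linarith) (by linarith),
    Real.log_mul (by linarith) (by linarith)] at htel
  have habs := (le_abs_self _).trans (htel.trans hηT)
  have hlhs : 0 < Zloop H S₁ y * Zloop H' S₂ y := by positivity
  have hrhs : 0 < (1 + θ) * (Zloop H' S₁ y * Zloop H S₂ y) := by positivity
  rw [← Real.log_le_log_iff hlhs hrhs, Real.log_mul (by linarith) (by linarith),
    Real.log_mul (by linarith) (by positivity), Real.log_mul (by linarith) (by linarith)]
  linarith

end Summit.CriticalPhenomena.SAWScalingLimit.Theorems.MassiveWindowSLE.Birth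

end
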